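import Summits.HodgeConjecture.HodgeConjecture.Theorems.SignSymmetricPowersFourFactsTorus
import Summits.HodgeConjecture.HodgeConjecture.Theorems.SignSymmetricPowersSignThreefoldPowersHodge
import Summits.HodgeConjecture.HodgeConjecture.Theorems.SmoothHypersurfaceGeometricGenus
import Literature.AlgebraicGeometry.HodgeTheory.PicardLefschetzSymmetricA3OfUniform
import HarnessLib

/-!
# Crux K1-B `VeryGeneralSignCommutatorsInHg` (route `SignSymmetricPowers`, stmt-HodgeConjecture-19716) and the rung leaf
# `SignThreefoldPowersHodge` modulo {hPL, hCDK, hA3}: the Picard–Lefschetz existence half of hB2-PL DISCHARGED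

Prover seat `hodge-nonav-19716-p2` (g9), cell `hodge-nonav`, programme «B2PL-SPLIT».  Landed
`--supports stmt-HodgeConjecture-19716` (helper); sorry-free, no definition, no new named fact.  CONDITIONAL results;
nothing here says HC ∕ HC_AV is proved; rung F-H1 is not moved.

THE RE-CUT.  Registry v18 of K1-B (19716-p2 g8) = {hPL, hCDK, hB2-PL}, hB2-PL = «for every symmetric `A₃` datum and every
bifurcation datum, the Picard–Lefschetz clauses (ii) of hB2 (`SymmetricA3PicardLefschetzClauses`: (P1)(P2) Picard–Lefschetz
data along the two circles with a common coefficient, (C) the `A₃` chain `±1`, (N) non-commutation) on some radius».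
Programme B2PL-SPLIT proved, in `Literature/AlgebraicGeometry/HodgeTheory/`:
* `SymmetricA3MonodromyRelations` — Clauses ⟺ Pair ∧ Relations (gauge re-choice by a rational rotation of the
  orthogonal pair; `symmetricA3PicardLefschetzClauses_of_pair_of_relations` and its converse), where
  `SymmetricA3MonodromyRelations n d f₁ g₀ g₂ ψ εa` speaks only of THE rational transports `T₁, T₂` along the two
  circles: `T₁T₂ ≠ T₂T₁ ∧ N₁N₂N₁ = ((−1)ⁿ·2)·N₁` (`N = T − 1`);
* `PicardLefschetzSymmetricA3OfUniform` — Pair ⟸ hPL = `picardLefschetz_nodalForms_uniform` (the typing seat's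
  «Picard–Lefschetz data at any radius» on prover-Bx's transport lemma, the flat coefficient giving the COMMON `c₀`),
  hence hB2-PL ⟸ hPL ∧ hA3 and hB2 ⟸ hPL ∧ hA3, with
  hA3 := «∀ symmetric `A₃` datum, ∀ bifurcation datum, ∃ radius `0 < εa' ≤ εa`, `SymmetricA3MonodromyRelations … εa'`»
  (stated INLINE below; the registry may name it).
This file re-runs p659179's composition with hA3 in the hB2-PL slot:

* `veryGeneralSignCommutatorsInHg_of_three_facts_A3 (hPL) (hCDK) (hA3)` — K1-B ⟸ {hPL, hCDK, hA3};
* `signThreefoldPowersHodge_of_three_facts_A3` — the rung-F-H1 leaf likewise.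

Registry consequence (P3's call): 19716 v19 = {hPL, hCDK, hA3}; hA3 is implied by hB2 (`picardLefschetz_symmetricA3.exists_relations`)
and, with hPL, implies it (`picardLefschetz_symmetricA3_of_uniform_of_relations`).
-/

set_option linter.dupNamespace false

namespace Summit.HodgeConjecture.HodgeConjecture.Theorems.SignSymmetricPowersK1BOfPLA3

open Literature.AlgebraicGeometry.HodgeTheory

/-- **Crux K1-B modulo {hPL, hCDK, hA3}.**  The very general member of the `ι`-even family has its sign commutators in the
Hodge group, GRANTED the uniform nodal Picard–Lefschetz package hPL, Cattani–Deligne–Kaplan hCDK, and the `A₃` operator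
relations hA3 of the two local monodromies at every symmetric `A₃` point (inline). -/
theorem veryGeneralSignCommutatorsInHg_of_three_facts_A3
    (hPL : Literature.AlgebraicGeometry.HodgeTheory.picardLefschetz_nodalForms_uniform)
    (hCDK : Literature.AlgebraicGeometry.HodgeTheory.cmsp_nonHodgeGenericPoints_countable_algebraic_cover)
    (hA3 : ∀ (n d : ℕ) (f₁ g₀ g₂ : MvPolynomial (Fin (n + 2)) ℂ) (j k : Fin (n + 2)) (a : Fin (n + 2) → ℂˣ),
      f₁.IsHomogeneous d → g₀.IsHomogeneous d → g₂.IsHomogeneous d → IsSymmetricA3Datum f₁ g₀ g₂ j k a →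
      ∀ (εa εb : ℝ) (ψ : ℂ → ℂ), IsSymmetricA3Bifurcation f₁ g₀ g₂ j a εa εb ψ →
        ∃ εa' : ℝ, 0 < εa' ∧ εa' ≤ εa ∧ SymmetricA3MonodromyRelations n d f₁ g₀ g₂ ψ εa') :
    Summit.HodgeConjecture.HodgeConjecture.Theses.SignSymmetricPowers.VeryGeneralSignCommutatorsInHg :=
  SignSymmetricPowersFourFactsTorus.veryGeneralSignCommutatorsInHg_of_genusBound_three_facts
    SmoothHypersurfaceGeometricGenus.stub_genusBoundThreefold @hPL @hCDK
    (picardLefschetz_symmetricA3_of_uniform_of_relations hPL hA3)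

/-- **The rung-F-H1 leaf `SignThreefoldPowersHodge` modulo {hPL, hCDK, hA3}** (HC for all powers of the very general
`ι`-even threefold), by `signThreefoldPowersHodge_of_veryGeneralSignCommutatorsInHg`. -/
theorem signThreefoldPowersHodge_of_three_facts_A3
    (hPL : Literature.AlgebraicGeometry.HodgeTheory.picardLefschetz_nodalForms_uniform)
    (hCDK : Literature.AlgebraicGeometry.HodgeTheory.cmsp_nonHodgeGenericPoints_countable_algebraic_cover)
    (hA3 : ∀ (n d : ℕ) (f₁ g₀ g₂ : MvPolynomial (Fin (n + 2)) ℂ) (j k : Fin (n + 2)) (a : Fin (n + 2) → ℂˣ),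
      f₁.IsHomogeneous d → g₀.IsHomogeneous d → g₂.IsHomogeneous d → IsSymmetricA3Datum f₁ g₀ g₂ j k a →
      ∀ (εa εb : ℝ) (ψ : ℂ → ℂ), IsSymmetricA3Bifurcation f₁ g₀ g₂ j a εa εb ψ →
        ∃ εa' : ℝ, 0 < εa' ∧ εa' ≤ εa ∧ SymmetricA3MonodromyRelations n d f₁ g₀ g₂ ψ εa') :
    Summit.HodgeConjecture.HodgeConjecture.Theses.SignSymmetricPowers.SignThreefoldPowersHodge :=
  SignSymmetricPowersSignThreefoldPowersHodge.signThreefoldPowersHodge_of_veryGeneralSignCommutatorsInHg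
    (veryGeneralSignCommutatorsInHg_of_three_facts_A3 @hPL @hCDK @hA3)

end Summit.HodgeConjecture.HodgeConjecture.Theorems.SignSymmetricPowersK1BOfPLA3
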